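import Mathlib
import HarnessLib
import Summits.QuantumFields.YangMills.Theorems.HypercubicLimit.Negative.ReflectedDensity
import Summits.QuantumFields.YangMills.Theorems.FradkinShenkerFlowFiniteSusceptibilityWeakCouplingRPCauchySchwarz
import Summits.QuantumFields.YangMills.Theorems.LangevinControlUVOSLegsFromFemtoAndGapStubAssemblyLatticeDist
import Summits.QuantumFields.YangMills.Theorems.LangevinControlUVOSLegsFromFemtoAndGapStubAssemblyShiftDefect
import Literature.MathematicalPhysics.AQFT.OSAxiomsSchwinger
import Literature.MathematicalPhysics.QuantumFieldTheory.OSData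
import Literature.MathematicalPhysics.QuantumLattice.LatticeScalarField
import Literature.MathematicalPhysics.QuantumFieldTheory.LatticeGaugeStaticPotentialProofs
import Literature.Probability.LatticeModels.ThermodynamicLimit

/-!
# c1 blocks, wave 3, for the closure of line `conditional-mean-telescoping` (crux stmt-QuantumFields-8646)

(i) transport of the diagonal RP-spectral slab clustering of `GapData` (iii) from the time axis to any
coordinate axis `μ` (hypercubic symmetry of the torus state); (ii) the per-argument SHIFT DEFECT of a
weighted lattice sum over a sub-domain of the box is `O(a)` under the sibling toolkit's collar bound
(`norm_sum_weight_shift_sub_le` applied to `W · 1_D`); (iii) PLANE EXPANSION: the toolkit's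
`latticeDist` of the curvature species is the sum over plaquette-orientation strings of the
plaquette-string moments; (iv) the BOUNDARY SLICE of the box (multi-indices with one corner at sup-norm
`≥ L ≥ a⁻²`) contributes `O(a)` by Schwartz decay alone.  Def-free statements; each `theorem` is
registered (`workitem stub-add`) and proved in its own `--supports` file.
-/

noncomputable section

open scoped SchwartzMap ComplexConjugate
open MeasureTheory Filter Topology
open Literature.MathematicalPhysics.AQFT Literature.MathematicalPhysics.QuantumLattice
open Literature.MathematicalPhysics.QuantumFieldTheory
open Literature.Probability.LatticeModels (box Site)
open Summit.QuantumFields.YangMills.Theorems.HypercubicLimit.Negative (torusPlaquette thetaZ)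
open Summit.QuantumFields.YangMills.Theorems.OSLegsFromFemtoAndGap (latticeDist torusMoment)

namespace Summit.QuantumFields.YangMills.Cruxes.HypercubicLimit.ConditionalMeanTelescoping

/-- **Block TRANSPORT (slab clustering along any axis).** If on the odd torus of side `2S+1` every
bounded measurable functional of the TIME slab `[1, T]` obeys the diagonal RP-spectral clustering
inequality (reflection `Θ`, translation by `n e₀`, rate factor `θ`, slack `ε B²`), then every bounded
measurable functional of the `μ`-SLAB `[1, T]_μ` obeys the same inequality with the transported
reflection `Θ_μ = π Θ π` (`π` = the axis swap `0 ↔ μ`, tree `configPerm`) and translation by `n e_μ`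
(invariance of Wilson's torus measure under `configPerm`, intertwining of `torusLift`/`configShift`). -/
theorem rpBlock_slabTransport :
    ∀ (G : Type) [Group G] [TopologicalSpace G] [IsTopologicalGroup G] [CompactSpace G]
      [MeasurableSpace G] [BorelSpace G] (r : LatticeRep G) (β : ℝ) (S T n : ℕ) (θ ε : ℝ) (μ : Fin 4),
      (∀ (Y : LGConfig 4 G → ℝ) (B : ℝ), Measurable Y → (∀ U, |Y U| ≤ B) →
        DependsOn Y {e : Literature.MathematicalPhysics.QuantumLattice.ZdEdge 4 |
          1 ≤ e.1 0 ∧ e.1 0 + (if e.2 = 0 then 1 else 0) ≤ T} →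
          |(∫ U, Y (torusLift (2 * S + 1) (GaugeConfig.timeReflect U)) *
                Y (configShift (-Pi.single 0 (n : ℤ)) (torusLift (2 * S + 1) U))
              ∂(wilsonMeasure r.ρ β : Measure (GaugeConfig 4 (2 * S + 1) G))) -
            (∫ U, Y (torusLift (2 * S + 1) U)
              ∂(wilsonMeasure r.ρ β : Measure (GaugeConfig 4 (2 * S + 1) G))) ^ 2| ≤
            θ * ((∫ U, Y (torusLift (2 * S + 1) (GaugeConfig.timeReflect U)) * Y (torusLift (2 * S + 1) U)
                    ∂(wilsonMeasure r.ρ β : Measure (GaugeConfig 4 (2 * S + 1) G))) -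
                  (∫ U, Y (torusLift (2 * S + 1) U)
                    ∂(wilsonMeasure r.ρ β : Measure (GaugeConfig 4 (2 * S + 1) G))) ^ 2) +
              ε * B ^ 2) →
      ∀ (Y : LGConfig 4 G → ℝ) (B : ℝ), Measurable Y → (∀ U, |Y U| ≤ B) →
        DependsOn Y {e : Literature.MathematicalPhysics.QuantumLattice.ZdEdge 4 |
          1 ≤ e.1 μ ∧ e.1 μ + (if e.2 = μ then 1 else 0) ≤ T} →
          |(∫ U, Y (torusLift (2 * S + 1) (configPerm (Equiv.swap 0 μ)
                  (GaugeConfig.timeReflect (configPerm (Equiv.swap 0 μ) U)))) *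
                Y (configShift (-Pi.single μ (n : ℤ)) (torusLift (2 * S + 1) U))
              ∂(wilsonMeasure r.ρ β : Measure (GaugeConfig 4 (2 * S + 1) G))) -
            (∫ U, Y (torusLift (2 * S + 1) U)
              ∂(wilsonMeasure r.ρ β : Measure (GaugeConfig 4 (2 * S + 1) G))) ^ 2| ≤
            θ * ((∫ U, Y (torusLift (2 * S + 1) (configPerm (Equiv.swap 0 μ)
                      (GaugeConfig.timeReflect (configPerm (Equiv.swap 0 μ) U)))) * Y (torusLift (2 * S + 1) U)
                    ∂(wilsonMeasure r.ρ β : Measure (GaugeConfig 4 (2 * S + 1) G))) -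
                  (∫ U, Y (torusLift (2 * S + 1) U)
                    ∂(wilsonMeasure r.ρ β : Measure (GaugeConfig 4 (2 * S + 1) G))) ^ 2) +
              ε * B ^ 2 := by
  sorry

/-- **Block SHIFT (per-argument shift defect on a sub-domain is `O(a)`).** For abstract real weights
`W` with sup bound `Mⁿ` and the sibling toolkit's collar bound, a sub-domain `D` of the box, a test
function `G ∈ ⁰𝒮ₙ` and a constant shift `c` with `‖c l‖ ≤ a ≤ 1/4`:
`‖∑_{x ∈ D} W(x) (G(a x + c) − G(a x))‖ ≤ 2 ‖c‖ Kⁿ Σ⁺(G)` — the toolkit's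
`norm_sum_weight_shift_sub_le` (with `s₁ = 0`, `s₂ = 1`) applied to `W · 1_D`. -/
theorem rpBlock_shiftDefect :
    ∀ (n L : ℕ) (C ℓ₄ M a : ℝ) (W : (Fin n → Site 4) → ℝ) (D : Finset (Fin n → Site 4))
      (c : Fin n → EuclideanSpace ℝ (Fin 4)) (G : 𝓢((Fin n → EuclideanSpace ℝ (Fin 4)), ℂ)),
      0 < ℓ₄ → 0 ≤ C → 0 ≤ M → (∀ x, |W x| ≤ M ^ n) →
      (∀ (x : Fin n → Site 4) (R : ℕ), 1 ≤ R → (R : ℝ) * a ≤ ℓ₄ → 4 * R + 8 ≤ L →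
        (∀ i j : Fin n, i ≠ j → ∃ k : Fin 4,
          (2 * (R : ℤ) + 4) ≤ |((((x i k - x j k : ℤ) : ZMod (2 * L + 1))).valMinAbs : ℤ)|) →
        |W x| ≤ (C / (R : ℝ) ^ 4) ^ n) →
      0 < a → a ≤ 1 → a ≤ ℓ₄ → 14 ≤ L → a⁻¹ * a⁻¹ ≤ L → 2 ≤ n → a ≤ 1 / 4 →
      IsOffDiagonal G → (∀ l, ‖c l‖ ≤ a) → D ⊆ Fintype.piFinset (fun _ : Fin n => box 4 L) →
        ‖∑ x ∈ D, ((W x : ℝ) : ℂ) *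
            (G (fun l => a • siteToE (x l) + c l) - G (fun l => a • siteToE (x l)))‖ ≤
          2 * ‖c‖ * ((M * 4 ^ 4 * 5 ^ 6 + M * 2 ^ 6 * (10 + 2 * (0 + 1)) ^ 4 +
              16 * C * 2 ^ 6 * (2 / ℓ₄ + 48) ^ 4) * 2 ^ 6 * (81 * ∑' m : ℕ, (((m : ℝ) + 1) ^ 2)⁻¹)) ^ n *
            (SchwartzMap.seminorm ℂ 0 (4 * n + 1) G + SchwartzMap.seminorm ℂ (6 * n) (4 * n + 1) G +
              SchwartzMap.seminorm ℂ 0 1 G + SchwartzMap.seminorm ℂ (6 * n) 1 G +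
              SchwartzMap.seminorm ℂ (10 * n) 1 G) := by
  sorry

/-- **Block PLANE (plane expansion of the curvature's lattice distribution).** The sibling toolkit's
`latticeDist` of the curvature species `r.curvature.F` (= the six plaquettes at a corner), centred by
`∑_q m_q`, is the sum over orientation strings `q` of the centred plaquette-string torus moments paired
with `F(a x)` (`torusDensity_eq_sum` + multilinear expansion `Finset.prod_univ_sum`). -/
theorem rpBlock_planeExpansion :
    ∀ (G : Type) [Group G] [TopologicalSpace G] [IsTopologicalGroup G] [CompactSpace G]
      [MeasurableSpace G] [BorelSpace G] (r : LatticeRep G) (β : ℝ) (L : ℕ) (a : ℝ)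
      (m : {q : Fin 4 × Fin 4 // q.1 < q.2} → ℝ) (n : ℕ)
      (F : 𝓢((Fin n → EuclideanSpace ℝ (Fin 4)), ℂ)),
      latticeDist r.ρ β L a r.curvature.F (∑ q : {q : Fin 4 × Fin 4 // q.1 < q.2}, m q) n F =
        ∑ q : Fin n → {q : Fin 4 × Fin 4 // q.1 < q.2},
          ∑ x ∈ Fintype.piFinset (fun _ : Fin n => box 4 L),
            (((∫ U, ∏ k, (torusPlaquette r (2 * L + 1) (q k).1.1 (q k).1.2 (x k) U - m (q k))
                ∂(wilsonMeasure r.ρ β : Measure (GaugeConfig 4 (2 * L + 1) G)) : ℝ) : ℂ)) *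
              F (fun k => a • siteToE (x k)) := by
  sorry

/-- **Block SLICE (the boundary slice of the box is `O(a)` by Schwartz decay).** For abstract real
weights with sup bound `Mⁿ`, spacing `0 < a ≤ 1` and half-side `L ≥ a⁻²`, the part of the weighted sum
`∑ W(x) F(a x)` over multi-indices of the box OUTSIDE a sub-domain `D` whose complement lies in the far
zone (`‖x l‖ ≥ L` for some `l`) is at most `Mⁿ · 2^{16n+2} · Zⁿ · |F|_{10n+1,0} · a`. -/
theorem rpBlock_boundarySlice :
    ∀ (n L : ℕ) (M a : ℝ) (W : (Fin n → Site 4) → ℝ) (D : Finset (Fin n → Site 4))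
      (F : 𝓢((Fin n → EuclideanSpace ℝ (Fin 4)), ℂ)),
      0 ≤ M → (∀ x, |W x| ≤ M ^ n) → 0 < a → a ≤ 1 → a⁻¹ * a⁻¹ ≤ L →
      D ⊆ Fintype.piFinset (fun _ : Fin n => box 4 L) →
      (∀ x ∈ Fintype.piFinset (fun _ : Fin n => box 4 L), x ∉ D → ∃ l, (L : ℝ) ≤ ‖x l‖) →
        ‖∑ x ∈ Fintype.piFinset (fun _ : Fin n => box 4 L) \ D,
            ((W x : ℝ) : ℂ) * F (fun l => a • siteToE (x l))‖ ≤
          M ^ n * 2 ^ (16 * n + 2) * (81 * ∑' m : ℕ, (((m : ℝ) + 1) ^ 2)⁻¹) ^ n *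
            SchwartzMap.seminorm ℂ (10 * n + 1) 0 F * a := by
  sorry

end Summit.QuantumFields.YangMills.Cruxes.HypercubicLimit.ConditionalMeanTelescoping

end
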